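import Summits.NavierStokesRegularity.NavierStokesRegularity.Theorems.SoloSalvageWu2026ConstructSobolevCore
import Summits.NavierStokesRegularity.NavierStokesRegularity.Theorems.SoloSalvageWu2026ConstructSobolevNineHalves
import Mathlib.MeasureTheory.Function.L2Space
import Mathlib.Analysis.MeanInequalities
import HarnessLib

/-!
# C177 `Wu2026` — sub-binder (E) of `Step_construct` (the Sobolev bounds (3.35) of the Euler
# blow-down tangent on `{|y| > 1}`) REDUCED to a uniform local `L^{9/5}` gradient bound at good
# scales (cell `pub/ns-inputs`, seat `ns-in-wu-con`; route business of `GaldiLiouvilleGate`, item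
# stmt-NavierStokesRegularity-0897)

Piece (E) of `step_construct_of_pieces` (`SoloSalvageWu2026Construct.lean`), exactly hypothesis `hE`
there, from the single analytic input that is not yet a tree theorem, typed as the hypothesis `hG2`:

  (G2) at good scales `R_j = 2^{n_j}`, for every ball `B(c, r)` with `1 + r < |c|`,
       `sup_j ∫_{B(c,r)} |∇V_j|^{9/5} < ∞`

(in print: (3.32)–(3.34) p.13 — the one-sided strong vorticity bounds `a_{n_j+m} ≤ B_m` of
Lemma 3.1, `div V_j = 0`, and the local div–curl / Calderón–Zygmund estimate). Given (G2): the weak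
partial derivatives `g_{k,i} ∈ L^{9/5}_loc({|y| > 1})` of the `L⁴_loc`-limit `V` exist
(`exists_weakGradient_of_localGradBound`, `…SobolevCore`), `V ∈ L^{9/2}_loc({|y| > 1})`
(`integrableOn_nineHalves_of_localGradBound`, `…SobolevNineHalves`); this file assembles the columns
`G y k = Σ_i g_{k,i}(y) e_i`, bounds `(Σ_k |G_k|²)^{9/10} ≤ 27 Σ_{k,i} |g_{k,i}|^{9/5}`, and passes from
the componentwise identities to the vector identity `∫ ∂_kφ V = −∫ φ G_k` of `Tangent.sobolev`.

Theorems only, standard axioms, no `sorry`.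

WHAT THIS IS NOT: not a proof of `Step_construct` (the gradient bounds (G1), (G2) and piece (B)
remain); not a claim about NS regularity or blow-up; not a claim about any author beyond the typed
locator.
-/

set_option linter.dupNamespace false

noncomputable section

open MeasureTheory Set Filter Topology Module Metric TopologicalSpace
open scoped ENNReal NNReal Topology RealInnerProductSpace Pointwise

namespace Summit.NavierStokesRegularity.NavierStokesRegularity.Theorems.Wu2026Salvage

open Literature.Analysis.FluidPDE Literature.Analysis.FunctionSpaces Literature.Claims.NS.Wu2026

/-- The pointwise bound behind the integrability of `|∇V|^{9/5}` from its nine components: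
`(Σ_k |Σ_i a_{k,i} e_i|²)^{9/10} ≤ 27 Σ_{k,i} |a_{k,i}|^{9/5}`. [folklore] -/
theorem rpow_sum_norm_sq_le (a : Fin 3 × Fin 3 → ℝ) :
    (∑ k : Fin 3, ‖∑ i : Fin 3, a (k, i) • (EuclideanSpace.single i (1 : ℝ) : E3)‖ ^ 2) ^
        ((9 : ℝ) / 10) ≤ 27 * ∑ ki : Fin 3 × Fin 3, |a ki| ^ ((9 : ℝ) / 5) := by
  set s : ℝ := ∑ ki : Fin 3 × Fin 3, |a ki| with hs_def
  have hs0 : 0 ≤ s := Finset.sum_nonneg fun ki _ => abs_nonneg _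
  have he1 : ∀ i : Fin 3, ‖(EuclideanSpace.single i (1 : ℝ) : E3)‖ = 1 := fun i => by
    refine (PiLp.norm_single 2 (fun _ : Fin 3 => ℝ) i (1 : ℝ)).trans ?_; simp
  -- each column is bounded by `s`
  have hcol : ∀ k : Fin 3, ‖∑ i : Fin 3, a (k, i) • (EuclideanSpace.single i (1 : ℝ) : E3)‖ ≤ s := by
    intro k
    calc ‖∑ i : Fin 3, a (k, i) • (EuclideanSpace.single i (1 : ℝ) : E3)‖
        ≤ ∑ i : Fin 3, ‖a (k, i) • (EuclideanSpace.single i (1 : ℝ) : E3)‖ := norm_sum_le _ _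
      _ = ∑ i : Fin 3, |a (k, i)| := by
          refine Finset.sum_congr rfl fun i _ => ?_
          rw [norm_smul, he1, mul_one, Real.norm_eq_abs]
      _ ≤ s := by
          rw [hs_def, Fintype.sum_prod_type]
          exact Finset.single_le_sum (f := fun k' => ∑ i : Fin 3, |a (k', i)|)
            (fun k' _ => Finset.sum_nonneg fun i _ => abs_nonneg _) (Finset.mem_univ k)
  have hsum : ∑ k : Fin 3, ‖∑ i : Fin 3, a (k, i) • (EuclideanSpace.single i (1 : ℝ) : E3)‖ ^ 2 ≤
      3 * s ^ 2 := by
    calc ∑ k : Fin 3, ‖∑ i : Fin 3, a (k, i) • (EuclideanSpace.single i (1 : ℝ) : E3)‖ ^ 2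
        ≤ ∑ _k : Fin 3, s ^ 2 := Finset.sum_le_sum fun k _ =>
          pow_le_pow_left₀ (norm_nonneg _) (hcol k) 2
      _ = 3 * s ^ 2 := by simp
  -- `(3 s²)^{9/10} ≤ 3 s^{9/5}`
  have h1 : (3 * s ^ 2) ^ ((9 : ℝ) / 10) ≤ 3 * s ^ ((9 : ℝ) / 5) := by
    rw [Real.mul_rpow (by norm_num) (sq_nonneg _)]
    have h3 : (3 : ℝ) ^ ((9 : ℝ) / 10) ≤ 3 := by
      have := Real.rpow_le_rpow_of_exponent_le (by norm_num : (1 : ℝ) ≤ 3)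
        (by norm_num : (9 : ℝ) / 10 ≤ 1)
      rwa [Real.rpow_one] at this
    have hs2 : (s ^ 2) ^ ((9 : ℝ) / 10) = s ^ ((9 : ℝ) / 5) := by
      rw [show s ^ 2 = s ^ (2 : ℝ) by exact_mod_cast (Real.rpow_natCast s 2).symm,
        ← Real.rpow_mul hs0]
      norm_num
    rw [hs2]
    exact mul_le_mul_of_nonneg_right h3 (Real.rpow_nonneg hs0 _)
  -- `s^{9/5} ≤ 9^{4/5} Σ |a|^{9/5} ≤ 9 Σ |a|^{9/5}`
  have h2 : s ^ ((9 : ℝ) / 5) ≤ 9 * ∑ ki : Fin 3 × Fin 3, |a ki| ^ ((9 : ℝ) / 5) := by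
    have h := Real.rpow_sum_le_const_mul_sum_rpow (Finset.univ : Finset (Fin 3 × Fin 3)) a
      (by norm_num : (1 : ℝ) ≤ (9 : ℝ) / 5)
    have hcard : ((Finset.univ : Finset (Fin 3 × Fin 3)).card : ℝ) = 9 := by simp
    rw [hcard] at h
    refine h.trans (mul_le_mul_of_nonneg_right ?_ (Finset.sum_nonneg fun ki _ =>
      Real.rpow_nonneg (abs_nonneg _) _))
    have := Real.rpow_le_rpow_of_exponent_le (by norm_num : (1 : ℝ) ≤ 9)
      (by norm_num : (9 : ℝ) / 5 - 1 ≤ 1)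
    rwa [Real.rpow_one] at this
  calc (∑ k : Fin 3, ‖∑ i : Fin 3, a (k, i) • (EuclideanSpace.single i (1 : ℝ) : E3)‖ ^ 2) ^
        ((9 : ℝ) / 10) ≤ (3 * s ^ 2) ^ ((9 : ℝ) / 10) :=
        Real.rpow_le_rpow (Finset.sum_nonneg fun k _ => sq_nonneg _) hsum (by norm_num)
    _ ≤ 3 * s ^ ((9 : ℝ) / 5) := h1
    _ ≤ 3 * (9 * ∑ ki : Fin 3 × Fin 3, |a ki| ^ ((9 : ℝ) / 5)) := by gcongr
    _ = 27 * ∑ ki : Fin 3 × Fin 3, |a ki| ^ ((9 : ℝ) / 5) := by ring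

/-- On a set of finite measure, `|g|^{9/5} ∈ L¹` gives `g ∈ L¹`. [folklore] -/
theorem integrableOn_of_integrableOn_abs_rpow {g : E3 → ℝ} {K : Set E3} (hK : volume K ≠ ∞)
    (hgm : AEStronglyMeasurable g volume)
    (hg : IntegrableOn (fun y => |g y| ^ ((9 : ℝ) / 5)) K volume) : IntegrableOn g K volume := by
  have hg' : IntegrableOn (fun y => ‖g y‖ ^ ((9 : ℝ) / 5)) K volume := by
    simpa only [Real.norm_eq_abs] using hg
  have hfin := lintegral_enorm_rpow_lt_top_of_integrableOn (by norm_num) hg'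
  refine ⟨hgm.restrict, ?_⟩
  rw [hasFiniteIntegral_iff_enorm]
  have h := setLIntegral_rpow_le_of_lt (K := K) hgm.enorm.restrict (s := 1) (r := (9 : ℝ) / 5)
    one_pos (by norm_num)
  simp only [ENNReal.rpow_one] at h
  exact h.trans_lt (ENNReal.mul_lt_top (ENNReal.rpow_lt_top_of_nonneg (by norm_num) hfin.ne)
    (ENNReal.rpow_lt_top_of_nonneg (by norm_num) hK))

/-- **Sub-binder (E) of `Step_construct` from the uniform local gradient bound (G2)** (p.13 l.6–83:
«V_j is bounded in W^{1,9/5} on compact subsets of {|y| > 1} … V ∈ W^{1,9/5}_loc ∩ L^{9/2}_loc({|y| > 1})»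
— (3.32)–(3.35)). The conclusion is hypothesis `hE` of `step_construct_of_pieces` verbatim.
[cite: Wu2026, (3.32)–(3.35) p.13 l.6–83] -/
theorem step_construct_pieceE_of_localGradBound
    (hG2 : ∀ ν : ℝ, 0 < ν → ∀ (v : E3 → E3) (p : E3 → ℝ), IsWuFlow ν v p →
      MemWeakLp v ((9 : ℝ≥0∞) / 2) volume →
      (∀ q : ℝ, 1 < q → q < 9 / 2 → ∃ C : ℝ, ∀ R : ℝ, 0 < R →
        IntegrableOn (fun x => ‖v x‖ ^ q) (annulus R) ∧
        (∫ x in annulus R, ‖v x‖ ^ q) ^ (1 / q) ≤ C * R ^ (-(2 : ℝ) / 3 + 3 / q)) →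
      ∀ n : ℕ → ℕ, Tendsto n atTop atTop →
        (∀ m : ℕ, ∃ B : ℝ, ∀ j : ℕ, max 1 m ≤ j → dyMass v (n j + m) ≤ B) →
      ∀ c : E3, ∀ r : ℝ, 0 < r → 1 + r < ‖c‖ → ∃ C : ℝ, ∀ j : ℕ,
        ∫ y in ball c r, ‖fderiv ℝ (blowDown ((2 : ℝ) ^ n j) v) y‖ ^ ((9 : ℝ) / 5) ≤ C) :
    ∀ ν : ℝ, 0 < ν → ∀ (v : E3 → E3) (p : E3 → ℝ), IsWuFlow ν v p →
      MemWeakLp v ((9 : ℝ≥0∞) / 2) volume →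
      (∀ q : ℝ, 1 < q → q < 9 / 2 → ∃ C : ℝ, ∀ R : ℝ, 0 < R →
        IntegrableOn (fun x => ‖v x‖ ^ q) (annulus R) ∧
        (∫ x in annulus R, ‖v x‖ ^ q) ^ (1 / q) ≤ C * R ^ (-(2 : ℝ) / 3 + 3 / q)) →
      ∀ n : ℕ → ℕ, Tendsto n atTop atTop →
        (∀ m : ℕ, ∃ B : ℝ, ∀ j : ℕ, max 1 m ≤ j → dyMass v (n j + m) ≤ B) →
      ∀ V : E3 → E3, AEStronglyMeasurable V volume →
        (∀ K : Set E3, IsCompact K → K ⊆ punctured →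
          IntegrableOn (fun y => ‖V y‖ ^ (4 : ℝ)) K) →
        (∀ K : Set E3, IsCompact K → K ⊆ punctured →
          Tendsto (fun j => ∫ y in K, ‖blowDown ((2 : ℝ) ^ n j) v y - V y‖ ^ (4 : ℝ))
            atTop (𝓝 0)) →
      ∃ G : E3 → Fin 3 → E3,
        (∀ K : Set E3, IsCompact K → K ⊆ exterior →
          IntegrableOn (fun y => (∑ k, ‖G y k‖ ^ 2) ^ ((9 : ℝ) / 10)) K ∧
          IntegrableOn (fun y => ‖V y‖ ^ ((9 : ℝ) / 2)) K) ∧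
        ∀ φ : E3 → ℝ, IsTest exterior φ → ∀ k : Fin 3,
          ∫ y, (fderiv ℝ φ y (EuclideanSpace.single k 1)) • V y = -∫ y, φ y • G y k := by
  intro ν hν v p hflow hweak h318 n hn hgood V hVm hVint hconvV
  obtain ⟨g, hgm, hgint, hgid⟩ := exists_weakGradient_of_localGradBound hG2 hν hflow hweak h318 hn
    hgood hVm hVint hconvV
  set e : Fin 3 → E3 := fun i => EuclideanSpace.single i 1 with he_def
  have he1 : ∀ i, ‖e i‖ = 1 := fun i => by
    refine (PiLp.norm_single 2 (fun _ : Fin 3 => ℝ) i (1 : ℝ)).trans ?_; simp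
  have hee : ∀ i i' : Fin 3, ⟪e i, e i'⟫ = if i = i' then 1 else 0 := fun i i' => by
    simp only [he_def]
    rw [EuclideanSpace.inner_single_left]
    simp [PiLp.single_apply]
  set G : E3 → Fin 3 → E3 := fun y k => ∑ i, g (k, i) y • e i with hG_def
  have hGi : ∀ y k i, ⟪e i, G y k⟫ = g (k, i) y := fun y k i => by
    simp only [hG_def, inner_sum, inner_smul_right, hee]
    simp
  have hGm : ∀ k, AEStronglyMeasurable (fun y => G y k) volume := fun k =>
    Finset.aestronglyMeasurable_fun_sum _ fun i _ => (hgm (k, i)).smul aestronglyMeasurable_const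
  refine ⟨G, fun K hK hKext => ⟨?_, integrableOn_nineHalves_of_localGradBound hG2 hν hflow hweak
    h318 hn hgood hVm hVint hconvV hK hKext⟩, fun φ hφ k => ?_⟩
  ----------------------------------------------------------------
  -- `|G|^{9/5}` is locally integrable on the exterior region
  ----------------------------------------------------------------
  · have hD : Integrable (fun y => 27 * ∑ ki : Fin 3 × Fin 3, |g ki y| ^ ((9 : ℝ) / 5))
        (volume.restrict K) :=
      (integrable_finsetSum _ fun ki _ => hgint K hK hKext ki).const_mul 27
    have hmeas : AEStronglyMeasurable (fun y => (∑ k, ‖G y k‖ ^ 2) ^ ((9 : ℝ) / 10))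
        (volume.restrict K) := by
      have h1 : AEMeasurable (fun y => ∑ k, ‖G y k‖ ^ 2) (volume.restrict K) :=
        Finset.aemeasurable_fun_sum _ fun k _ => ((hGm k).norm.aemeasurable.pow_const 2).restrict
      exact (h1.pow_const _).aestronglyMeasurable
    refine Integrable.mono' hD hmeas (Eventually.of_forall fun y => ?_)
    rw [Real.norm_of_nonneg (Real.rpow_nonneg (Finset.sum_nonneg fun k _ => sq_nonneg _) _)]
    exact rpow_sum_norm_sq_le (fun ki => g ki y)
  ----------------------------------------------------------------
  -- the vector identity from the component identities
  ----------------------------------------------------------------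
  · have hcomp : ∀ i, ∫ y, fderiv ℝ φ y (e k) * ⟪V y, e i⟫ = -∫ y, φ y * g (k, i) y :=
      fun i => hgid φ hφ k i
    obtain ⟨hφs, hφc, hφp⟩ := hφ
    set Kφ : Set E3 := tsupport φ with hKφ_def
    have hKφ : IsCompact Kφ := hφc
    have hKφp : Kφ ⊆ punctured := hφp.trans exterior_subset_punctured
    have hKφfin : volume Kφ ≠ ∞ := hKφ.measure_lt_top.ne
    have hφ1 : ContDiff ℝ 1 φ := hφs.of_le (by norm_cast)
    have hφcont : Continuous φ := hφs.continuous
    have hDφcont : Continuous (fderiv ℝ φ) := hφ1.continuous_fderiv one_ne_zero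
    obtain ⟨Mφ, hMφ⟩ := hφcont.bounded_above_of_compact_support hφc
    obtain ⟨MD, hMD⟩ := hDφcont.bounded_above_of_compact_support (hφc.fderiv (𝕜 := ℝ))
    -- `V ∈ L¹(Kφ)`
    have hVK : IntegrableOn V Kφ volume := by
      have hV4 := lintegral_enorm_rpow_lt_top_of_integrableOn (by norm_num) (hVint Kφ hKφ hKφp)
      refine ⟨hVm.restrict, ?_⟩
      rw [hasFiniteIntegral_iff_enorm]
      have h := setLIntegral_rpow_le_of_lt (K := Kφ) hVm.enorm.restrict (s := 1) (r := (4 : ℝ))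
        one_pos (by norm_num)
      simp only [ENNReal.rpow_one] at h
      exact h.trans_lt (ENNReal.mul_lt_top (ENNReal.rpow_lt_top_of_nonneg (by norm_num) hV4.ne)
        (ENNReal.rpow_lt_top_of_nonneg (by norm_num) hKφfin))
    -- `G_k ∈ L¹(Kφ)`
    have hGK : IntegrableOn (fun y => G y k) Kφ volume :=
      integrable_finsetSum _ fun i _ =>
        (integrableOn_of_integrableOn_abs_rpow hKφfin (hgm (k, i)) (hgint Kφ hKφ hφp (k, i))).smul_const
          (e i)
    -- the two vector integrands are integrable
    have iL : Integrable (fun y => (fderiv ℝ φ y (e k)) • V y) volume := by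
      have hfun : (fun y => (fderiv ℝ φ y (e k)) • V y) =
          Kφ.indicator (fun y => (fderiv ℝ φ y (e k)) • V y) := by
        funext y
        by_cases hy : y ∈ Kφ
        · rw [indicator_of_mem hy]
        · rw [indicator_of_notMem hy, fderiv_of_notMem_tsupport ℝ hy]; simp
      rw [hfun, integrable_indicator_iff hKφ.measurableSet]
      refine Integrable.mono' (hVK.norm.const_mul MD)
        ((hDφcont.clm_apply continuous_const).aestronglyMeasurable.smul hVm).restrict
        (Eventually.of_forall fun y => ?_)
      rw [norm_smul]
      refine mul_le_mul_of_nonneg_right ?_ (norm_nonneg _)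
      calc ‖fderiv ℝ φ y (e k)‖ ≤ ‖fderiv ℝ φ y‖ * ‖e k‖ := (fderiv ℝ φ y).le_opNorm _
        _ ≤ MD := by rw [he1, mul_one]; exact hMD y
    have iR : Integrable (fun y => φ y • G y k) volume := by
      have hfun : (fun y => φ y • G y k) = Kφ.indicator (fun y => φ y • G y k) := by
        funext y
        by_cases hy : y ∈ Kφ
        · rw [indicator_of_mem hy]
        · rw [indicator_of_notMem hy, image_eq_zero_of_notMem_tsupport hy, zero_smul]
      rw [hfun, integrable_indicator_iff hKφ.measurableSet]
      refine Integrable.mono' (hGK.norm.const_mul Mφ)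
        (hφcont.aestronglyMeasurable.smul (hGm k)).restrict (Eventually.of_forall fun y => ?_)
      rw [norm_smul]
      exact mul_le_mul_of_nonneg_right (hMφ y) (norm_nonneg _)
    -- componentwise
    have key : ∀ i, ⟪e i, ∫ y, (fderiv ℝ φ y (e k)) • V y⟫ = ⟪e i, -∫ y, φ y • G y k⟫ := by
      intro i
      rw [← integral_inner iL, inner_neg_right, ← integral_inner iR]
      simp_rw [real_inner_smul_right, hGi]
      have h := hcomp i
      have h' : ∫ y, fderiv ℝ φ y (e k) * ⟪e i, V y⟫ = ∫ y, fderiv ℝ φ y (e k) * ⟪V y, e i⟫ :=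
        integral_congr_ae (Eventually.of_forall fun y => by
          show fderiv ℝ φ y (e k) * ⟪e i, V y⟫ = fderiv ℝ φ y (e k) * ⟪V y, e i⟫
          rw [real_inner_comm])
      rw [h', h]
    refine ext_inner_left ℝ fun w => ?_
    rw [← (EuclideanSpace.basisFun (Fin 3) ℝ).sum_repr' w]
    simp only [sum_inner, real_inner_smul_left, EuclideanSpace.basisFun_apply]
    exact Finset.sum_congr rfl fun i _ => by rw [key i]

end Summit.NavierStokesRegularity.NavierStokesRegularity.Theorems.Wu2026Salvage

end

-- WHAT THIS IS NOT: not a claim about NS regularity or blow-up; not a claim about any author beyond the typed locator.
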